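import Mathlib
import HarnessLib
import HarnessLib.Audit
import Summits.QuantumAdvantage.Statement
import Literature.Computability.Cryptography.ClassBQP
import Literature.Computability.Complexity.ProbabilisticClasses
import Literature.Computability.Complexity.Classes
import Literature.Computability.Complexity.BoolEncodings
import Literature.Computability.QuantumComplexity.ApproxHiddenCosetOracle
import HarnessLib.Audit.Status.Attr

/-!
Route: AreaUncertainty

# Route AreaUncertainty — area |X||T|/|G| sorts Fourier sampling — bounded area forces hidden
cosets, porous pairs die by fractal uncertainty

It suffices to show X = GraphHSPHard — verbatim the hypothesis-type target of route BochnerSampling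
(stmt-QuantumAdvantage-2621):
an FP family hiding graph subgroups {(d_x t, t)} of (ℤ/N_x)² exactly whose slope-bit language is not
in BPP; with the shared
support GraphHSPInBQP (Shor's two-register standard method) X gives the summit by pure logic. That
bridge is BORROWED and shared
(items dedup by signature). What this route EARNS is the converse structure theory of the
single-QFT-layer normal form FH₂, organised
by one number — the AREA a(X,T) = |X|·|T|/|G| of a fibre–window pair (card
area-fup-fourier-sampling; = the Landau–Pollak–Slepian /
Donoho–Stark time–bandwidth product = ‖1_T F 1_X‖²_HS). (i) PIN + ENERGY: (K,ε)-flatness of the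
Fourier-sampling law forces mean
area ≤ K (trivial character), and bounded area converts decodable mass into additive energy, E(X_v)
≥ (A_v²/a_v)|X_v|³ (support
AreaEnergyBound; with BSG + PFR the 1%-core BoundedAreaCore of FlatLawRigidity). (ii) MAJOR ARCS:
bounded area + (1−η)-acceptance ⇒
the fibre law is δ-close to a mixture of ≤ L(K,δ) uniform coset laws (crux PairStability); mixtures
of LARGE cosets 3/4-embedded in a
window collapse to short mixtures (crux LargeCosetCollapse); the two glue to BochnerSampling's
FlatLawRigidity (support RigidityGlue)
— an alternative decomposition of stmt-2622 sharing the decl (D-0019). (iii) MINOR ARCS / NO-GO: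
ν-porous fibre–window pairs in
Shor's register ℤ/N have acceptance ≤ C·N^(−β(ν)) (crux PorousFUP = discrete fractal uncertainty),
and the failure locus on Simon's
register is exhibited exactly: the digit alphabets {0,2}/{0,1} saturate the Walsh sandwich at area 1
(WalshCantorSaturates) but
decay like N^(−1/4) under the ℤ/4^k QFT (CyclicCantorDecays).
Lean: `∃ (F : List Bool → List Bool) (Nf d : List Bool → ℕ), F ∈
Literature.Computability.Complexity.FP ∧ (fun x => Computability.encodeNat (Nf x)) ∈
Literature.Computability.Complexity.FP ∧ (∀ x, 2 ≤ Nf x ∧ d x < Nf x) ∧ (∀ x, ∀ a b a' b' : ℕ, a <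
Nf x → b < Nf x → a' < Nf x → b' < Nf x → (F (Literature.Computability.Complexity.boolPair x
(Literature.Computability.Complexity.boolPair (Computability.encodeNat a) (Computability.encodeNat
b))) = F (Literature.Computability.Complexity.boolPair x
(Literature.Computability.Complexity.boolPair (Computability.encodeNat a') (Computability.encodeNat
b'))) ↔ ((a : ZMod (Nf x)) - (d x : ZMod (Nf x)) * b = (a' : ZMod (Nf x)) - (d x : ZMod (Nf x)) *
b'))) ∧ {w : List Bool | ∃ (x : List Bool) (i : ℕ), w = Literature.Computability.Complexity.boolPair
x (Computability.encodeNat i) ∧ (d x).testBit i = true} ∉ Literature.Computability.Complexity.BPP`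

## Assembly
Pure logic, identical to route BochnerSampling's assembly (shared item stmt-QuantumAdvantage-2627;
re-proved sorry-free as
`assembly_holds` in the planner's Sketch.lean, axioms propext/Classical.choice/Quot.sound):
GraphHSPHard supplies F, N, d with the
slope-bit language L ∉ BPP; GraphHSPInBQP puts the same L in BQP; ⟨L, ·, ·⟩ witnesses
QuantumAdvantage = ∃ L ∈ BQP, L ∉ BPP. The
ranked cruxes are the converse programme (which single-QFT-layer witnesses CAN exist) and are
deliberately not hypotheses of the
assembly; their internal wiring is the typed support RigidityGlue : PairStability →
LargeCosetCollapse → FlatLawRigidity.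

Rationale: WHY THIS LINE. FH₂ (one superposed query to a P-function f, one QFT, measure; Shi2005 §4, Shor1997,
Simon1997) samples D_f = Σ_v p_v·λ_v where
λ_v(c) = |1̂_(X_v)(c)|²/(|X_v||G|) is the law of the fibre X_v = f⁻¹(v); a classical post-processor
decodes from a window T, and the
pair (X_v, T) is governed by the uncertainty sandwich 1_T F 1_(X_v), whose Hilbert–Schmidt mass is
the area |X_v||T|/|G|
(DonohoStark1989, Meshulam2006: area-1 extremisers are cosets). Imported areas: (a) finite-abelian
uncertainty / restriction theory
— the L⁴–additive-energy control of sandwiches (DyatlovZahl2016 §0.2 forwards; IosevichMayeli2025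
and IosevichJamingMayeli2026 Thm
3.11–3.12 prove "small energy ⇒ annihilating pair"), read BACKWARDS here: decodable mass at bounded
area IS near-maximal energy,
hence (BSG, TaoVu2006 §2.5; PFR, GowersEtAl2025) hidden cosets — this executes the largeness step
route BochnerSampling left open for
stmt-2622 without its AlmostBinary step; (b) the quantitative idempotent / spectral-norm structure
theory (GreenSanders2008,
CheungHatamiZhaoZilberstein2024) whose measure-version at sparse support is exactly
PairStability/LargeCosetCollapse; (c) the
fractal uncertainty principle of quantum chaos (BourgainDyatlov2018, DyatlovJin2017, Dyatlov2019,
DyatlovJinNonnenmacher2021) and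
its Walsh failure (Demeter2022WalshFUP) as a quantitative no-go for porous witnesses with the
Simon/Shor register dichotomy built
in. No prior route or card parametrises fibre–window pairs by area or points (fractal) uncertainty
principles at quantum Fourier
sampling; the negatives index (1 entry, KummerSector cubic characters) is untouched.

RANKED CRUXES. #0 GraphHSPHard (target) — there exist F ∈ FP and N, d with N_x ≥ 2 FP-computable and
d_x < N_x such that (a,b) ↦ F(⟨x,⟨a,b⟩⟩) separates exactly the cosets of the graph subgroup {(d_x t,
t)} of (ℤ/N_x)², and the bit language of d_x is not in BPP — verbatim route BochnerSampling's target
stmt-QuantumAdvantage-2621 (shared, hypothesis-type, never staffed). (why it might fail: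
hypothesis-type DLOG-style hardness (implies the summit with GraphHSPInBQP, hence all
SeparationPrerequisites); false if every FP hiding function leaks its slope classically —
unsupported either way.) [Shor1997, Kitaev1995, Shi2005]
#2 PairStability (crux) — BOUNDED-AREA STABILITY OF THE UNCERTAINTY PRINCIPLE on Simon's register
(card K1, per fibre, 99% form): for every K and δ > 0 there are η > 0 and L such that for all m and
all X, T ⊆ (ℤ/2)^m with area |X|·|T| ≤ K·2^m and acceptance Σ_(c∈T) |1̂_X(c)|² ≥ (1−η)|X|2^m, the
fibre law c ↦ |1̂_X(c)|²/(|X|2^m) is δ-close in ℓ¹ to a mixture of at most L uniform laws on cosets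
of subgroups (IsCosetMixture L). Area 1 with full acceptance is the Donoho–Stark/Meshulam equality
case (X a coset); unions of K cosets, products A × W with |A| ≤ K, and Shor/Simon windows all check
with L ≤ 2^(2K). [difficulty: L] (why it might fail: Nonnegativity: laws equal to Boolean
combinations of nested or partly transverse dual cosets (V^⊥ minus an index-J subgroup) need J−1
components or are only 2/J-close to one; such bookkeeping may force L to grow with m. BSG+PFR give
the 1% core only; no 99% peeling is known.) [DonohoStark1989, Meshulam2006, GreenSanders2008,
GowersEtAl2025, CheungHatamiZhaoZilberstein2024, IosevichMayeli2025]
#3 LargeCosetCollapse (crux) — COLLAPSE OF LARGE-COSET MIXTURES (the law-level half of card K1's ℓ¹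
upgrade): for every K and δ > 0 there is L such that every convex combination M = Σ_i w_i·Unif(c_i +
V_i) of uniform coset laws on (ℤ/2)^m, each component LARGE (|T| ≤ K·|V_i|) and 3/4-EMBEDDED in a
common finite window T (|(c_i+V_i) ∩ T| ≥ ¾|V_i|), is δ-close in ℓ¹ to a mixture of at most L
uniform coset laws. (M̂ has ℓ¹-mass ≤ K·2^m/|T|: when T is dense in a subgroup hub, Maurey sampling
+ conditional expectation on a bounded-codimension subgroup prove it; the content is that large
¾-embedded cosets cluster into boundedly many hubs.) [difficulty: M] (why it might fail: Needs large
3/4-embedded cosets to cluster into O_K(1) hubs where T has density 1/poly(K); chains of straddling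
cosets (neighbours sharing index-4 subgroups) might span hubs far larger than K|T|, leaving
quadric-indexed families whose averages are not coset-wise constant.) [GreenSanders2008,
CheungHatamiZhaoZilberstein2024, TaoVu2006, Meshulam2006]
#4 PorousFUP (crux) — DISCRETE POROUS FRACTAL UNCERTAINTY on Shor's register (card K2; the dilation
a·X, a⁻¹·T of the card is WLOG by the covariance F∘Dil_a = Dil_(a⁻¹)∘F): for every ν > 0 there are β
> 0 and C such that for all N and all X, T ⊆ ℤ/N that are ν-porous on scales 1/ν … N (every arc of ℓ
consecutive residues, 1/ν ≤ ℓ ≤ N, contains νℓ consecutive residues missing the set), every u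
supported on X has Σ_(k∈T) |𝓕u(k)|² ≤ C·N^(1−β)·‖u‖² (𝓕 = Mathlib's unnormalised ZMod.dft, so this
is operator norm ≤ √C·N^(−β/2) for the unitary QFT): porous fibres have exponentially small
acceptance in every porous window. [difficulty: XL] (why it might fail: In print: continuum
porous/regular FUP (BourgainDyatlov2018, DJN21) and the discrete CANTOR case only (DyatlovJin2017
Thm 2; submultiplicativity is special to N = M^k). A general discrete porous FUP must push
Beurling-Malliavin through discretisation at scales near 1/nu: unwritten; XL to formalise.)
[BourgainDyatlov2018, DyatlovJin2017, Dyatlov2019, DyatlovJinNonnenmacher2021, Demeter2022WalshFUP,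
arXiv:2206.14131]
#5 FlatLawRigidity (crux) — dimension-free flatness rigidity over (ℤ/2)^m — verbatim route
BochnerSampling's crux stmt-QuantumAdvantage-2622 (shared decl; this route offers the alternative
decomposition PairStability → LargeCosetCollapse → FlatLawRigidity, support RigidityGlue): for every
K and δ > 0 there are ε > 0 and L such that every Fourier-sampling law D_f over (ℤ/2)^m with mass ≥
1−ε on a window T and no atom above K/|T| is δ-close in ℓ¹ to a mixture of at most L uniform coset
laws. [deps: PairStability, LargeCosetCollapse] [difficulty: L] (why it might fail: L ≥ K is forced
(t-fold HSP mixtures); unions of many transverse proper cosets with positivity restored by light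
atoms, or partitions with unboundedly many flatness classes, might force L to grow with |T|
(BochnerSampling); on this line, PairStability or LargeCosetCollapse may fail.) [DonohoStark1989,
GreenSanders2008, GowersEtAl2025, SchwarzVandenNest2013]
#9 AreaEnergyBound (support) — M2 of the card (Dyatlov–Zahl's L⁴ step read backwards; the symmetric
twin of IosevichMayeli2025's (4/3,2)-restriction estimate): for every finite abelian G, X ⊆ G, φ
with |φ| ≤ 1 and every finite set T of characters, (Σ_(ψ∈T) |Σ_(x∈X) φ(x)ψ(x)|²)² ≤ |T|·|G|·E(X,X) —
one Cauchy–Schwarz over T plus Σ_ψ |S(ψ)|⁴ = |G|·E_φ(X) ≤ |G|·E(X) (character orthogonality; Mathlib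
Finset.addEnergy). Normalised: E(X) ≥ (A²/a)·|X|³ for acceptance A and area a. [difficulty:
provable-now] [DyatlovZahl2016, IosevichMayeli2025, IosevichJamingMayeli2026, TaoVu2006]
#9 BoundedAreaCore (support) — THE 1%-CORE OF stmt-2622, modulo the two named theorems spelled as
hypotheses (no Literature fact exists yet; cite requests filed): PFR over 𝔽₂ⁿ (GowersEtAl2025 Thm
1.1: |A+A| ≤ K|A| ⇒ A covered by ≤ 2K^C₀ translates of a subgroup of size ≤ |A|) → BSG (TaoVu2006
Thm 2.29/2.31: E(A) ≥ |A|³/K ⇒ A' ⊆ A with |A'| ≥ |A|/(C₁K^C₁), |A'+A'| ≤ C₁K^C₁|A'|) → there is C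
such that for every (K,ε)-flat cube law D_f with window T (mass ≥ 1−ε on T, atoms ≤ K/|T|), the
fibres X_v containing a subset of density ≥ 1/(C·K^C) inside a coset of a subgroup of size ≤ |X_v|
carry p-mass ≥ 3/4 − 2ε (counted as #{y : fibre of y is structured} ≥ (3/4−2ε)·2^m). Proof: pin
D_f(0) = Σ_v|X_v|²/4^m ≤ K/|T| ⇒ mean area ≤ K; Markov twice (A_v ≥ 1/2 off p-mass 2ε, a_v ≤ 4K off
p-mass 1/4); AreaEnergyBound ⇒ E(X_v) ≥ |X_v|³/(16K); BSG; PFR; pigeonhole. [difficulty: M]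
[GowersEtAl2025, TaoVu2006, DyatlovZahl2016, GreenSanders2008]
#9 RigidityGlue (support) — the glue of the foreseen split of FlatLawRigidity (kind glue, filed as
support): PairStability → LargeCosetCollapse → FlatLawRigidity. Parameter flow (no circularity
because LargeCosetCollapse uses the FIXED fraction 3/4): given K, δ put θ = δ₁ = δ/64, K' = ⌈K/θ⌉;
PairStability(K',δ₁) gives η, L'; η₀ = min(η,θ), ε = θ·η₀, K'' = ⌈L'K'/θ⌉, L = L_collapse(K'', δ/2).
Pin + Markov drop fibres with a_v > K' or A_v < 1−η₀ (p-mass ≤ 2θ); replace each good fibre law by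
its L'-mixture (δ₁); drop components with |V| < |T|/K'' (weight ≤ L'K'/K'' + δ₁ ≤ θ+δ₁, since
fibre-law atoms are ≤ a_v/|T|) and components not 3/4 inside T (weight ≤ 4(η₀+δ₁)); renormalise;
apply LargeCosetCollapse; total ℓ¹ error ≤ 2(7θ+6δ₁) + δ/2 < δ. Needs D_f = Σ_v p_v·λ_v, i.e.
(−1)^(c·(y−y')) = (−1)^(c·y)(−1)^(c·y') with the .val-sum parities. [difficulty: M]
[GreenSanders2008, DonohoStark1989]
#9 WalshCantorSaturates (support) — THE FAILURE LOCUS ON SIMON'S REGISTER (Demeter's Walsh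
counterexample in its simplest digit form): for every k, in (ℤ/2)^(2k) the set X = {x : x_i = 0 for
even i} (numbers whose base-4 digits lie in {0,2}, little-endian bits) and the window T = {c : c_i =
0 for odd i} (base-4 digits in {0,1}) have area exactly 1 (|X|·|T| = 4^k) and FULL acceptance
Σ_(c∈T) (Σ_(x∈X) (−1)^(c·x))² = |X|·4^k: both sets are porous digit-Cantor sets, yet the
Walsh–Hadamard sandwich has norm 1 because T = X^⊥ — subgroups exist at every dyadic scale.
[difficulty: provable-now] [Demeter2022WalshFUP, Simon1997, DonohoStark1989]
#9 CyclicCantorDecays (support) — THE SAME DIGIT PAIR DIES ON SHOR'S REGISTER: for every k and every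
u : ℤ/4^k → ℂ supported on X = {x : all base-4 digits of x in {0,2}}, the Fourier mass on the window
T = {y : all base-4 digits in {0,1}} obeys Σ_(y∈T) |𝓕u(y)|² ≤ 2^k·‖u‖² (unnormalised ZMod.dft; i.e.
operator norm ≤ 2^(−k/2) = N^(−1/4) for the unitary QFT although the area (|X||T|/N = 1) gives only
the trivial bound 1). Proof: the level-one sandwich rows {0,1} × columns {0,2} of F₄/2 is
(1/2)[[1,1],[1,−1]], norm r₁ = 1/√2 < 1, and Dyatlov–Jin's submultiplicativity Lemma 2.2 (general
X₁,Y₁,X₂,Y₂; position set C_k(A) = C_(k₁)(A) + 4^(k₁)C_(k₂)(A), frequency set likewise) gives r_k ≤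
r₁^k. [difficulty: M] [DyatlovJin2017, LaiShi2025, Shor1997]
#9 GraphHSPInBQP (support) — Shor's two-register standard method over ℤ/N × ℤ/N with an abstract FP
hiding function puts the bit language of the slope in uniform Clifford+T BQP — verbatim route
BochnerSampling's support stmt-QuantumAdvantage-2626 (shared). [difficulty: L] [Shor1997,
Kitaev1995, BrassardHoyer1997]

TWO-LAYER PLAN. FlatLawRigidity ⇐ PairStability → LargeCosetCollapse → FlatLawRigidity (glue already
typed: RigidityGlue; file the split when either
child closes). PairStability ⇐ PairCore (BoundedAreaCore specialised to one pair: a 1/poly(K)-dense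
coset piece) → Peeling (removing
the piece leaves a pair of area ≤ K and acceptance ≥ 1 − η − losses summable over ≤ L(K,δ) rounds) →
PairStability. LargeCosetCollapse
⇐ HubClustering (large ¾-embedded cosets lie in ≤ h(K) subgroups H_j with |H_j| ≤ K^c|T|) →
DenseCollapse (T dense in a subgroup:
Maurey sampling of M̂, ‖M̂‖₁ ≤ K·2^m/|T|, + conditional expectation on a codim-O(K⁴/δ²) subgroup;
provable) → LargeCosetCollapse.
PorousFUP ⇐ PorousToRegular (discrete version of DyatlovJinNonnenmacher2021's porous ⇒ δ-regular,
δ(ν) < 1) → RegularFUPDiscrete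
(BourgainDyatlov2018 Thm 4 transported to ℤ/N via 1/N-neighbourhoods) → PorousFUP. k ≤ 3 each, depth
1; nothing filed now.

KILL CRITERIA. PairStability refuted by an explicit bounded-area, (1−η)-accepting family whose fibre
laws stay δ-far from every L-mixture: if the
witnesses extend to level-set partitions (e.g. they tile) FlatLawRigidity dies with it (shared with
BochnerSampling) — close
`refuted:PairStability` unless the witness class is itself a bounded structure (signed coset
combinations, quadric classes), in which
case ONE restate of the conclusion to that class. LargeCosetCollapse refuted ⇒ restate with the hub
hypothesis (T dense in a
subgroup) — the glue then needs a hub lemma — or drop the glue line; the route survives on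
PairStability + BoundedAreaCore as "bounded
area ⇒ 1% cosets, 99% per fibre". PorousFUP refuted by porous discrete pairs with σ bounded below ⇒
drop the minor-arc half (the digit
case CyclicCantorDecays / DyatlovJin2017 stays as known support) — informative: a porous, non-coset,
decodable structure in Shor's
register. GraphHSPHard is hypothesis-type and never staffed; GraphHSPInBQP failing as typed is a
re-type, not a kill. The route is
`superseded` by BochnerSampling only if stmt-2622 closes there by its own split AND PorousFUP is
settled.

NOT DECOMPOSED YET. The cyclic twin of PairStability (Shor's register: coset PROGRESSIONS / shifted
Bohr sets, feeding BochnerSampling's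
FlatLawRigidityCyclic stmt-2623 — Freiman in ℤ/N is only quasi-polynomial and progressions vs Bohr
sets differ in ℓ¹); the unifying
conjecture GeneralisedAreaStability ("‖λ̂‖₁·|T|/|G| ≤ K and λ(T) ≥ 1−η ⇒ λ is a short coset mixture"
for ANY law λ — it implies
PairStability but NOT the ¾-form of LargeCosetCollapse: (3/4)Unif(U) + (1/4)Unif(random half of U'),
|U'| = |U|², is a
counterexample to the ¾-variant); the white-box SECTOR THEOREM (card K3: BPP with stateless
(K,ε)-flat Fourier-sampling calls ⊆
BPP^AHC, porous calls droppable) — needs the class BPPFS requested by BochnerSampling (FH2Necessity,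
stmt-2688) and is not typed here;
the general-alphabet discrete Cantor FUP (KNOWN: DyatlovJin2017 Thm 2 with Lemmas 2.2/2.6 for
arbitrary proper digit alphabets A ≠ B;
requested as a cite fact, not an item); quantitative dependence of (η, L) on (K, δ); odd
characteristic and the
Childs–Schulman–Vazirani quadric laws (unbounded area: minor-arc sector, other routes); the
operator-norm/HS identities
‖1_T F 1_X‖²_HS = |X||T|/|G| and dilation covariance (folded into proofs, not items).

CHEAPEST FALSIFIER. Spine (PairStability): enumerate m ≤ 10 over structured X (unions of ≤ 3 cosets
of distinct subgroups, products A × W, weight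
slices, base-4 digit sets, complements), mass-greedy window T at area ≤ K ∈ {1,2,4}; when acceptance
≥ 0.9 solve the LP "ℓ¹-distance
of the fibre law to the best mixture of ≤ 8 cosets" — one kit job; a family with distance bounded
below as m grows kills rank 2 (and,
if it tiles, stmt-2622). LargeCosetCollapse: quadric-indexed families of codim-2 cosets of
(ℤ/2)^(2r), r ≤ 5, same LP. FUP half:
σ_max numerics over ℤ/2^n, n ≤ 18 (card's list). DONE here (pure Python, no kit): {0,2}/{0,1}
sandwich in ℤ/4^k, k ≤ 5: unitary
σ = 2^(−k/2) EXACTLY (spectral pair, LaiShi2025 — CyclicCantorDecays is tight); other area-1 pairs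
at k = 4: ({0,2},{0,2}) 0.783,
({0,1},{0,1}) 0.721, ({0,3},{0,1}) 0.654, ({1,2},{0,2}) 0.250; Walsh sums = |X|·4^k verified k ≤ 5
(k = 1 by `decide`); M1/M2
normalisations re-derived and typed (rc 0).

NUMBERS. Area: abelian HSP a = 1 (|H||H^⊥| = |G|), Simon a = 1, Shor a = w (window fattening),
Hallgren Bohr windows a = O(1);
Childs–Schulman–Vazirani hidden radius a ≍ q^(d−1), Decker–Draisma–Wocjan a ≍ q, Roetteler
difference sets a ≍ √N (card).
Pin: mean area ≤ K for (K,ε)-flat laws; good fibres (A_v ≥ 1/2, a_v ≤ 4K) have p-mass ≥ 3/4 − 2ε and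
E(X_v) ≥ |X_v|³/(16K).
PFR: 2K^12 translates (GowersEtAl2025), 2K^11 (Liao). Quantitative Cohen: coset complexity ≤
exp(O(M^(3+o(1)))) (Sanders 2019/20);
approximate version tower-type (CheungHatamiZhaoZilberstein2024 Thm 2). Discrete Cantor FUP:
β(M,A,B) > max(0, 1/2 − δ)
(DyatlovJin2017 Thm 2), β ≤ (1−δ)/2 with equality iff distributed spectral pair (LaiShi2025 Thm
1.4); our pair M = 4, A = {0,2},
B = {0,1}: r₁ = 1/√2, β = 1/4 = (1−δ)/2 (a spectral pair: most uncertain case); Walsh twin: σ = 1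
for all k. Items at open: 12
(1 target, 4 cruxes, 6 supports, 1 assembly); shared with BochnerSampling: GraphHSPHard,
FlatLawRigidity, GraphHSPInBQP, Assembly.

DEFINITION REQUESTS. Cite facts wanted (filed after open with `ledger workitem add --kind cite`,
trunk Combinatorics/Additive resp. Analysis/Fourier):
PFR over 𝔽₂ⁿ (GowersEtAl2025 Thm 1.1) and Balog–Szemerédi–Gowers (TaoVu2006 Thm 2.29) — once landed,
BoundedAreaCore should be
restated with the named facts in place of its two inline hypotheses; Dyatlov–Jin discrete Cantor FUP
for arbitrary proper alphabets
(DyatlovJin2017 Thm 2 + Lemmas 2.2, 2.6); Bourgain–Dyatlov FUP for ν-porous sets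
(BourgainDyatlov2018 Thm 4 with
DyatlovJinNonnenmacher2021 §2). Definition wanted (optional, inlined for now): `IsPorousOn ν S ℓ₀
ℓ₁` for S ⊆ ZMod N (every arc of
length ℓ ∈ [ℓ₀, ℓ₁] contains ⌈νℓ⌉ consecutive residues outside S), topic
Literature/Analysis/Fourier. The sector theorem waits on
BPPFS (already requested by route BochnerSampling).

Novelty: Searches (2026-08-15): `lit search --source zbmath "uncertainty principle finite abelian groups"`
(20: Tao2005, Meshulam-adjacent,
Bonami–Ghobber, Delvaux–Van Barel rank-deficient Fourier submatrices, Alagic–Russell,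
Russell–Shparlinski, and arXiv:2502.13786
Jaming–Iosevich–Mayeli — READ pp. 10–11: Thm 3.11 (IM24's energy-restriction estimate) and Thm 3.12
"max_U Λ(U)/|U|²·|E| < N^d ⇒
strong annihilating pair"); `lit search --source zbmath "Boolean functions small spectral norm
cosets"` (1: CheungHatamiZhaoZilberstein2024
— READ Thm 2, Conj. 1, §4); `lit search --source arxiv "fractal uncertainty principle discrete
Cantor sets"` (6: Eswarathasan–Han,
Lai–Shi arXiv:2501.00864 — READ Thm 1.1/1.4, Han–Salekani, Cohen arXiv:2206.14131, Knutsen,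
Kangabire); `lit read arXiv:1608.02238`
(DyatlovJin2017: Thm 2, Lemma 2.2 submultiplicativity for general X_i, Y_i, Lemma 2.6 gap lemma, Cor
2.7 — READ pp. 3, 10–12);
`lit galaxy search "uncertainty principle quantum Fourier sampling hidden subgroup" --star all`
(0/0/0); `lit galaxy search --star pdf
--mode bm25 "additive energy of Fourier sampling fibres, bounded time-bandwidth area … fractal
uncertainty principle for quantum
Fourier transform"` (12: Childs–Kothari–Ozols–Roetteler, Roetteler difference sets, HSP course
notes, Shor's survey — no area /
uncertainty analysis of Fourier sampling); OpenAlex 429, arXiv API 429 this session; plus the card's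
two refuter audits (19, 20:
Donoho–Stark, Landau–Pollak–Slepian, Meshulam2006, Tao2005, B  [refs: 2502.13786, 2501.00864, 2206.14131, 1608.02238, Tao2005, CheungHatamiZhaoZilberstein2024, DyatlovJin2017, Meshulam2006, IosevichMayeli2025, IosevichJamingMayeli2026, DyatlovZahl2016, GreenSanders2008, LaiShi2025]

Barriers (technique_class: uncertainty-principle, additive-combinatorics, structure): - technique_class: uncertainty-principle, additive-combinatorics, structure
- Literature.Barriers.QuantumAdvantage.SeparationPrerequisites: it does not evade it and does not
engage it — no separation is claimed by the earned items (finite harmonic analysis on subset pairs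
of (ℤ/2)^m and ℤ/N); the summit arrow is the shared hypothesis-type GraphHSPHard, never staffed, to
which the barrier applies in full.
- Literature.Barriers.QuantumAdvantage.Relativization: consistent — PairStability /
LargeCosetCollapse / PorousFUP concern arbitrary fibres and windows and hold verbatim for oracle f
(they are WHY Simon/Shor/Bernstein–Vazirani need cosets); relative to oracles they say bounded-area
single-layer advantage = hidden cosets and porous pairs carry no mass, contradicting nothing known
(Simon's register is exactly where the porous no-go fails, WalshCantorSaturates).
- Literature.Barriers.QuantumAdvantage.Algebrization: n/a (no arithmetisation; structure
statements).
- Literature.Barriers.QuantumAdvantage.NaturalProofs: n/a — no circuit lower bound or constructive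
largeness property on Boolean functions is used; the statements classify promise structure, not
hardness.
- Literature.Barriers.QuantumAdvantage.TotalFunctionSpeedupLimit: consistent and sharpened — for
unstructured/porous total structure the acceptance is ≤ N^(−β): an exponent where the polynomial
method gives a degree bound; the route only licenses hidden-coset (promise) families.
- Literature.Barriers.QuantumAdvantage.Ra

sub-problem: QuantumAdvantage · status: open · opened planner-plancard-QuantumAdvantage-QuantumAdva-7a08b417-0 2026-08-15T14:04:54Z · rev 1 · ledger route-QuantumAdvantage-AreaUncertainty
GENERATED by the gate from the ledger (D-0016/17). Provers cite these decls: `theorem foo : Summit.QuantumAdvantage.QuantumAdvantage.Theses.AreaUncertainty.<Decl> := …` in Summits/QuantumAdvantage/QuantumAdvantage/Theorems/<Name>.lean.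
-/

namespace Summit.QuantumAdvantage.QuantumAdvantage.Theses.AreaUncertainty

open scoped BigOperators Topology Manifold Classical MeasureTheory ProbabilityTheory Matrix InnerProductSpace ComplexConjugate ContinuousMap
open Filter Set Function TopologicalSpace MeasureTheory

attribute [summit_statement] _root_.QuantumAdvantage

open Literature.QuantumAdvantage

/-- item stmt-QuantumAdvantage-2621 · target · rank 0 · open · by planner
why it might fail: Hypothesis-type DLOG-style hardness, never staffed: with GraphHSPInBQP it implies the summit, hence everything behind Barriers.SeparationPrerequisites (false if BPP = BQP, or if every FP graph-hiding function leaks its slope to a BPP machine); no unconditional evidence either way.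
sources: Shor1997, Kitaev1995, Shi2005
[target] there exist F ∈ FP and N, d with N_x ≥ 2 FP-computable and d_x < N_x such that (a,b) ↦
F(⟨x,⟨a,b⟩⟩) separates exactly the cosets of the graph subgroup {(d_x t, t)} of (ℤ/N_x)², and the
bit language of d_x is not in BPP (card item X_FS specialised to the abelian-HSP normal form). -/
@[route_item "route-QuantumAdvantage-AreaUncertainty", crux]
def GraphHSPHard : Prop :=
  ∃ (F : List Bool → List Bool) (Nf d : List Bool → ℕ), F ∈ Literature.Computability.Complexity.FP ∧ (fun x => Computability.encodeNat (Nf x)) ∈ Literature.Computability.Complexity.FP ∧ (∀ x, 2 ≤ Nf x ∧ d x < Nf x) ∧ (∀ x, ∀ a b a' b' : ℕ, a < Nf x → b < Nf x → a' < Nf x → b' < Nf x → (F (Literature.Computability.Complexity.boolPair x (Literature.Computability.Complexity.boolPair (Computability.encodeNat a) (Computability.encodeNat b))) = F (Literature.Computability.Complexity.boolPair x (Literature.Computability.Complexity.boolPair (Computability.encodeNat a') (Computability.encodeNat b'))) ↔ ((a : ZMod (Nf x)) - (d x : ZMod (Nf x)) * b = (a' : ZMod (Nf x)) - (d x : ZMod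 (Nf x)) * b'))) ∧ {w : List Bool | ∃ (x : List Bool) (i : ℕ), w = Literature.Computability.Complexity.boolPair x (Computability.encodeNat i) ∧ (d x).testBit i = true} ∉ Literature.Computability.Complexity.BPP

/-- item stmt-QuantumAdvantage-9605 · crux · rank 2 · open · by planner
why it might fail: L may be forced to grow with m at fixed (K,δ): only the 1%-core (BSG+PFR) is known, no 99% peeling; near-Boolean combinations of many nested/transverse dual cosets with positivity restored by light atoms could stay δ-far from every L-mixture (calibration on stmt-2622: L(2,δ) ≥ ½·log₂(1/δ)).
sources: DonohoStark1989, Meshulam2006, GreenSanders2008, GowersEtAl2025, CheungHatamiZhaoZilberstein2024, IosevichMayeli2025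
[crux] BOUNDED-AREA STABILITY OF THE UNCERTAINTY PRINCIPLE on Simon's register (card K1, per fibre,
99% form): for every K and δ > 0 there are η > 0 and L such that for all m and all X, T ⊆ (ℤ/2)^m
with area |X|·|T| ≤ K·2^m and acceptance Σ_(c∈T) |1̂_X(c)|² ≥ (1−η)|X|2^m, the fibre law c ↦
|1̂_X(c)|²/(|X|2^m) is δ-close in ℓ¹ to a mixture of at most L uniform laws on cosets of subgroups
(IsCosetMixture L). Area 1 with full acceptance is the Donoho–Stark/Meshulam equality case (X a
coset); unions of K cosets, products A × W with |A| ≤ K, and Shor/Simon windows all check with L ≤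
2^(2K). [difficulty: L] -/
@[route_item "route-QuantumAdvantage-AreaUncertainty"]
def PairStability : Prop :=
  ∀ (K : ℕ) (δ : ℝ), 0 < δ → ∃ η : ℝ, 0 < η ∧ ∃ L : ℕ, ∀ (m : ℕ) (X T : Finset (Fin m → ZMod 2)), X.Nonempty → ((X.card : ℝ) * T.card ≤ K * 2 ^ m) → ((1 - η) * X.card * 2 ^ m ≤ ∑ c ∈ T, (∑ x ∈ X, (-1 : ℝ) ^ (∑ i, (c i * x i).val)) ^ 2) → ∃ M : (Fin m → ZMod 2) → ℝ, Literature.Computability.QuantumComplexity.IsCosetMixture L M ∧ ∑ c : Fin m → ZMod 2, |(∑ x ∈ X, (-1 : ℝ) ^ (∑ i, (c i * x i).val)) ^ 2 / ((X.card : ℝ) * 2 ^ m) - M c| ≤ δ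

/-- item stmt-QuantumAdvantage-9606 · crux · rank 3 · open · by planner
why it might fail: Provable when T is a subgroup (Maurey sampling of M̂ + conditional expectation, L ≤ 2^O(K²/δ²)); for general T the large ¾-embedded cosets must cluster into O_K(1) hubs of size C(K)|T| — commensurable but drifting chains V_i ⊆ Pop(T+T) might span hubs of unbounded rank, with no bounded approximant.
sources: GreenSanders2008, CheungHatamiZhaoZilberstein2024, TaoVu2006, Meshulam2006
[crux] COLLAPSE OF LARGE-COSET MIXTURES (the law-level half of card K1's ℓ¹ upgrade): for every K
and δ > 0 there is L such that every convex combination M = Σ_i w_i·Unif(c_i + V_i) of uniform coset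
laws on (ℤ/2)^m, each component LARGE (|T| ≤ K·|V_i|) and 3/4-EMBEDDED in a common finite window T
(|(c_i+V_i) ∩ T| ≥ ¾|V_i|), is δ-close in ℓ¹ to a mixture of at most L uniform coset laws. (M̂ has
ℓ¹-mass ≤ K·2^m/|T|: when T is dense in a subgroup hub, Maurey sampling + conditional expectation on
a bounded-codimension subgroup prove it; the content is that large ¾-embedded cosets cluster into
boundedly many hubs.) [difficulty: M] -/
@[route_item "route-QuantumAdvantage-AreaUncertainty"]
def LargeCosetCollapse : Prop :=
  ∀ (K : ℕ) (δ : ℝ), 0 < δ → ∃ L : ℕ, ∀ (m n : ℕ) (T : Finset (Fin m → ZMod 2)) (w : Fin n → ℝ) (c₀ : Fin n → (Fin m → ZMod 2)) (V : Fin n → AddSubgroup (Fin m → ZMod 2)), (∀ i, 0 ≤ w i) → ∑ i, w i = 1 → (∀ i, (T.card : ℝ) ≤ K * Nat.card (V i)) → (∀ i, (3 : ℝ) / 4 * Nat.card (V i) ≤ (T.filter fun c => c - c₀ i ∈ V i).card) → ∃ M : (Fin m → ZMod 2) → ℝ, Literature.Computability.QuantumComplexity.IsCosetMixture L M ∧ ∑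 c : Fin m → ZMod 2, |∑ i, w i * Literature.Computability.QuantumComplexity.cosetUniformLaw (V i) (c₀ i) c - M c| ≤ δ

/-- item stmt-QuantumAdvantage-2622 · crux · rank 5 · open · by planner
why it might fail: L ≥ K is forced and L must grow as δ→0 already at K=2 (calibration: L(2,δ) ≥ ½·log₂(1/δ)); unions of many transverse proper cosets with positivity restored by light atoms, or unboundedly many flatness classes, might force L to grow with |T|; here it also dies with PairStability/LargeCosetCollapse.
sources: DonohoStark1989, GreenSanders2008, GowersEtAl2025, SchwarzVandenNest2013
[crux] dimension-free flatness rigidity over (ℤ/2)^m (card item R in its flat form): for every K and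
δ > 0 there are ε > 0 and L such that for all m, f : (ℤ/2)^m → ℕ and T, if the Fourier-sampling law
D_f puts mass ≥ 1 − ε on T and no point mass above K/|T|, then D_f is δ-close in ℓ¹ to a mixture of
at most L uniform laws on cosets of subgroups. [difficulty: L] -/
@[route_item "route-QuantumAdvantage-AreaUncertainty"]
def FlatLawRigidity : Prop :=
  ∀ (K : ℕ) (δ : ℝ), 0 < δ → ∃ ε : ℝ, 0 < ε ∧ ∃ L : ℕ, ∀ (m : ℕ) (f : (Fin m → ZMod 2) → ℕ) (T : Finset (Fin m → ZMod 2)), (1 - ε ≤ ∑ c ∈ T, (∑ y : Fin m → ZMod 2, ∑ y' : Fin m → ZMod 2, if f y = f y' then (-1 : ℝ) ^ (∑ i, (c i * (y i - y' i)).val) else 0) / (4 : ℝ) ^ m) → (∀ c : Fin m → ZMod 2, (∑ y : Fin m → ZMod 2, ∑ y' : Fin m → ZMod 2, if f y = f y' then (-1 : ℝ) ^ (∑ i, (c i * (y i - y' i)).val) else 0) / (4 : ℝ) ^ m ≤ K / (T.card : ℝ)) → ∃ (w : Fin L → ℝ) (c₀ : Fin L → (Fin m → ZMod 2)) (W : Fin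 L → AddSubgroup (Fin m → ZMod 2)), (∀ i, 0 ≤ w i) ∧ ∑ i, w i = 1 ∧ ∑ c : Fin m → ZMod 2, |(∑ y : Fin m → ZMod 2, ∑ y' : Fin m → ZMod 2, if f y = f y' then (-1 : ℝ) ^ (∑ i, (c i * (y i - y' i)).val) else 0) / (4 : ℝ) ^ m - ∑ i, w i * (if c - c₀ i ∈ W i then (1 : ℝ) / Nat.card (W i) else 0)| ≤ δ

/-- item stmt-QuantumAdvantage-9607 · support · rank 4 · open · by planner
why it might fail: In print: continuum porous/regular FUP (BourgainDyatlov2018, DJN21) and the discrete CANTOR case only (DyatlovJin2017 Thm 2; submultiplicativity is special to N = M^k). A general discrete porous FUP must push Beurling-Malliavin through discretisation at scales near 1/nu: unwritten; XL to formalise.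
sources: DyatlovJin2018, arXiv:1702.03619, DyatlovJinNonnenmacher2021, Dyatlov2019, BourgainDyatlov2018, DyatlovJin2017
[crux] DISCRETE POROUS FRACTAL UNCERTAINTY on Shor's register (card K2; the dilation a·X, a⁻¹·T of
the card is WLOG by the covariance F∘Dil_a = Dil_(a⁻¹)∘F): for every ν > 0 there are β > 0 and C
such that for all N and all X, T ⊆ ℤ/N that are ν-porous on scales 1/ν … N (every arc of ℓ
consecutive residues, 1/ν ≤ ℓ ≤ N, contains νℓ consecutive residues missing the set), every u
supported on X has Σ_(k∈T) |𝓕u(k)|² ≤ C·N^(1−β)·‖u‖² (𝓕 = Mathlib's unnormalised ZMod.dft, so this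
is operator norm ≤ √C·N^(−β/2) for the unitary QFT): porous fibres have exponentially small
acceptance in every porous window. [difficulty: XL] -/
@[route_item "route-QuantumAdvantage-AreaUncertainty"]
def PorousFUP : Prop :=
  ∀ ν : ℝ, 0 < ν → ∃ β : ℝ, 0 < β ∧ ∃ C : ℝ, ∀ (N : ℕ) [NeZero N] (X T : Finset (ZMod N)), (∀ (a : ZMod N) (ℓ : ℕ), 1 ≤ ν * ℓ → ℓ ≤ N → ∃ j₀ w : ℕ, j₀ + w ≤ ℓ ∧ ν * ℓ ≤ w ∧ ∀ i : ℕ, j₀ ≤ i → i < j₀ + w → a + (i : ZMod N) ∉ X) → (∀ (a : ZMod N) (ℓ : ℕ), 1 ≤ ν * ℓ → ℓ ≤ N → ∃ j₀ w : ℕ, j₀ + w ≤ ℓ ∧ ν * ℓ ≤ w ∧ ∀ i : ℕ, j₀ ≤ i → i < j₀ + w → a + (i : ZMod N) ∉ T) → ∀ u : ZMod N → ℂ, (∀ x, x ∉ X → u x = 0) → ∑ k ∈ T, ‖ZMod.dft u k‖ ^ 2 ≤ C * (N : ℝ) ^ (1 - β) * ∑ x, ‖u x‖ ^ 2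

/-- item stmt-QuantumAdvantage-2626 · support · rank 9 · open · by planner
sources: Shor1997, Kitaev1995, BrassardHoyer1997
[support] Shor's two-register standard method over ℤ/N × ℤ/N with an abstract FP hiding function
(Shor1997 §6 verbatim with φ(a − d b) for g^a y^(−b); candidate slopes are verifiable by f_x(d,1) =
f_x(0,0)) puts the bit language of the slope in uniform Clifford+T BQP; tree precedent
isQSolvable_dlog_holds, QFTZModPow. [difficulty: L] -/
@[route_item "route-QuantumAdvantage-AreaUncertainty", crux]
def GraphHSPInBQP : Prop :=
  ∀ (F : List Bool → List Bool) (Nf d : List Bool → ℕ), F ∈ Literature.Computability.Complexity.FP → (fun x => Computability.encodeNat (Nf x)) ∈ Literature.Computability.Complexity.FP → (∀ x, 2 ≤ Nf x ∧ d x < Nf x) → (∀ x, ∀ a b a' b' : ℕ, a < Nf x → b < Nf x → a' < Nf x → b' < Nf x → (F (Literature.Computability.Complexity.boolPair x (Literature.Computability.Complexity.boolPair (Computability.encodeNat a) (Computability.encodeNat b))) = F (Literature.Computability.Complexity.boolPair x (Literature.Computability.Complexity.boolPair (Computability.encodeNat a') (Computability.encodeNat b'))) ↔ ((a : ZMod (Nf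 x)) - (d x : ZMod (Nf x)) * b = (a' : ZMod (Nf x)) - (d x : ZMod (Nf x)) * b'))) → {w : List Bool | ∃ (x : List Bool) (i : ℕ), w = Literature.Computability.Complexity.boolPair x (Computability.encodeNat i) ∧ (d x).testBit i = true} ∈ Literature.Computability.Cryptography.BQP

/-- item stmt-QuantumAdvantage-9608 · support · rank 9 · open · by planner
sources: DyatlovZahl2016, IosevichMayeli2025, IosevichJamingMayeli2026, TaoVu2006
[support] M2 of the card (Dyatlov–Zahl's L⁴ step read backwards; the symmetric twin of
IosevichMayeli2025's (4/3,2)-restriction estimate): for every finite abelian G, X ⊆ G, φ with |φ| ≤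
1 and every finite set T of characters, (Σ_(ψ∈T) |Σ_(x∈X) φ(x)ψ(x)|²)² ≤ |T|·|G|·E(X,X) — one
Cauchy–Schwarz over T plus Σ_ψ |S(ψ)|⁴ = |G|·E_φ(X) ≤ |G|·E(X) (character orthogonality; Mathlib
Finset.addEnergy). Normalised: E(X) ≥ (A²/a)·|X|³ for acceptance A and area a. [difficulty:
provable-now] -/
@[route_item "route-QuantumAdvantage-AreaUncertainty"]
def AreaEnergyBound : Prop :=
  ∀ (G : Type) [AddCommGroup G] [Fintype G] [DecidableEq G] (X : Finset G) (φ : G → ℂ) (T : Finset (AddChar G ℂ)), (∀ x, ‖φ x‖ ≤ 1) → (∑ ψ ∈ T, ‖∑ x ∈ X, φ x * ψ x‖ ^ 2) ^ 2 ≤ (T.card : ℝ) * Fintype.card G * Finset.addEnergy X X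

/-- item stmt-QuantumAdvantage-9609 · support · rank 9 · open · by planner
sources: GowersEtAl2025, TaoVu2006, DyatlovZahl2016, GreenSanders2008
[support] THE 1%-CORE OF stmt-2622, modulo the two named theorems spelled as hypotheses (no
Literature fact exists yet; cite requests filed): PFR over 𝔽₂ⁿ (GowersEtAl2025 Thm 1.1: |A+A| ≤ K|A|
⇒ A covered by ≤ 2K^C₀ translates of a subgroup of size ≤ |A|) → BSG (TaoVu2006 Thm 2.29/2.31: E(A)
≥ |A|³/K ⇒ A' ⊆ A with |A'| ≥ |A|/(C₁K^C₁), |A'+A'| ≤ C₁K^C₁|A'|) → there is C such that for every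
(K,ε)-flat cube law D_f with window T (mass ≥ 1−ε on T, atoms ≤ K/|T|), the fibres X_v containing a
subset of density ≥ 1/(C·K^C) inside a coset of a subgroup of size ≤ |X_v| carry p-mass ≥ 3/4 − 2ε
(counted as #{y : fibre of y is structured} ≥ (3/4−2ε)·2^m). Proof: pin D_f(0) = Σ_v|X_v|²/4^m ≤
K/|T| ⇒ mean area ≤ K; Markov twice (A_v ≥ 1/2 off p-mass 2ε, a_v ≤ 4K off p-mass 1/4);
AreaEnergyBound ⇒ E(X_v) ≥ |X_v|³/(16K); BSG; PFR; pigeonhole. [difficulty: M] -/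
@[route_item "route-QuantumAdvantage-AreaUncertainty"]
def BoundedAreaCore : Prop :=
  (∃ C₀ : ℕ, ∀ (n : ℕ) (A : Finset (Fin n → ZMod 2)) (K : ℝ), A.Nonempty → ((((A ×ˢ A).image fun p => p.1 + p.2).card : ℝ) ≤ K * A.card) → ∃ (H : AddSubgroup (Fin n → ZMod 2)) (s : Finset (Fin n → ZMod 2)), (s.card : ℝ) ≤ 2 * K ^ C₀ ∧ Nat.card H ≤ A.card ∧ ∀ a ∈ A, ∃ x ∈ s, a - x ∈ H) → (∃ C₁ : ℕ, ∀ (G : Type) [AddCommGroup G] [Fintype G] [DecidableEq G] (A : Finset G) (K : ℝ), 1 ≤ K → A.Nonempty → ((A.card : ℝ) ^ 3 ≤ K * Finset.addEnergy A A) → ∃ A' : Finset G, A' ⊆ A ∧ (A.card : ℝ) ≤ C₁ * K ^ C₁ * A'.card ∧ ((((A' ×ˢ A').image fun p => p.1 + p.2).card : ℝ) ≤ C₁ * K ^ C₁ * A'.card)) → ∃ C : ℕ, ∀ (K : ℕ) (ε : ℝ) (m : ℕ) (f : (Fin m → ZMod 2) → ℕ) (T : Finset (Fin m → ZMod 2)),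 1 ≤ K → (1 - ε ≤ ∑ c ∈ T, Literature.Computability.QuantumComplexity.cubeFourierLaw f c) → (∀ c, Literature.Computability.QuantumComplexity.cubeFourierLaw f c ≤ K / (T.card : ℝ)) → (3 / 4 - 2 * ε) * (2 : ℝ) ^ m ≤ ((Finset.univ.filter fun y : Fin m → ZMod 2 => ∃ (W : AddSubgroup (Fin m → ZMod 2)) (c₀ : Fin m → ZMod 2), Nat.card W ≤ (Finset.univ.filter fun x : Fin m → ZMod 2 => f x = f y).card ∧ ((Finset.univ.filter fun x : Fin m → ZMod 2 => f x = f y).card : ℝ) ≤ C * K ^ C * (Finset.univ.filter fun x : Fin m → ZMod 2 => f x = f y ∧ x - c₀ ∈ W).card).card : ℝ)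

/-- item stmt-QuantumAdvantage-9610 · support · rank 9 · open · by planner
sources: GreenSanders2008, DonohoStark1989
[support] the glue of the foreseen split of FlatLawRigidity (kind glue, filed as support):
PairStability → LargeCosetCollapse → FlatLawRigidity. Parameter flow (no circularity because
LargeCosetCollapse uses the FIXED fraction 3/4): given K, δ put θ = δ₁ = δ/64, K' = ⌈K/θ⌉;
PairStability(K',δ₁) gives η, L'; η₀ = min(η,θ), ε = θ·η₀, K'' = ⌈L'K'/θ⌉, L = L_collapse(K'', δ/2).
Pin + Markov drop fibres with a_v > K' or A_v < 1−η₀ (p-mass ≤ 2θ); replace each good fibre law by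
its L'-mixture (δ₁); drop components with |V| < |T|/K'' (weight ≤ L'K'/K'' + δ₁ ≤ θ+δ₁, since
fibre-law atoms are ≤ a_v/|T|) and components not 3/4 inside T (weight ≤ 4(η₀+δ₁)); renormalise;
apply LargeCosetCollapse; total ℓ¹ error ≤ 2(7θ+6δ₁) + δ/2 < δ. Needs D_f = Σ_v p_v·λ_v, i.e.
(−1)^(c·(y−y')) = (−1)^(c·y)(−1)^(c·y') with the .val-sum parities. [difficulty: M] -/
@[route_item "route-QuantumAdvantage-AreaUncertainty"]
def RigidityGlue : Prop :=
  PairStability → LargeCosetCollapse → FlatLawRigidity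

/-- item stmt-QuantumAdvantage-9611 · support · rank 9 · open · by planner
sources: Demeter2022WalshFUP, Simon1997, DonohoStark1989
[support] THE FAILURE LOCUS ON SIMON'S REGISTER (Demeter's Walsh counterexample in its simplest
digit form): for every k, in (ℤ/2)^(2k) the set X = {x : x_i = 0 for even i} (numbers whose base-4
digits lie in {0,2}, little-endian bits) and the window T = {c : c_i = 0 for odd i} (base-4 digits
in {0,1}) have area exactly 1 (|X|·|T| = 4^k) and FULL acceptance Σ_(c∈T) (Σ_(x∈X) (−1)^(c·x))² =
|X|·4^k: both sets are porous digit-Cantor sets, yet the Walsh–Hadamard sandwich has norm 1 because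
T = X^⊥ — subgroups exist at every dyadic scale. [difficulty: provable-now] -/
@[route_item "route-QuantumAdvantage-AreaUncertainty"]
def WalshCantorSaturates : Prop :=
  ∀ k : ℕ, (∑ c ∈ (Finset.univ.filter fun c : Fin (2 * k) → ZMod 2 => ∀ i, i.val % 2 = 1 → c i = 0), (∑ x ∈ (Finset.univ.filter fun x : Fin (2 * k) → ZMod 2 => ∀ i, i.val % 2 = 0 → x i = 0), (-1 : ℝ) ^ (∑ i, (c i * x i).val)) ^ 2 = ((Finset.univ.filter fun x : Fin (2 * k) → ZMod 2 => ∀ i, i.val % 2 = 0 → x i = 0).card : ℝ) * 2 ^ (2 * k)) ∧ ((Finset.univ.filter fun x : Fin (2 * k) → ZMod 2 => ∀ i, i.val % 2 = 0 → x i = 0).card * (Finset.univ.filter fun c : Fin (2 * k) → ZMod 2 => ∀ i, i.val % 2 = 1 → c i = 0).card = 2 ^ (2 * k))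

/-- item stmt-QuantumAdvantage-9612 · support · rank 9 · open · by planner
sources: DyatlovJin2017, LaiShi2025, Shor1997
[support] THE SAME DIGIT PAIR DIES ON SHOR'S REGISTER: for every k and every u : ℤ/4^k → ℂ supported
on X = {x : all base-4 digits of x in {0,2}}, the Fourier mass on the window T = {y : all base-4
digits in {0,1}} obeys Σ_(y∈T) |𝓕u(y)|² ≤ 2^k·‖u‖² (unnormalised ZMod.dft; i.e. operator norm ≤
2^(−k/2) = N^(−1/4) for the unitary QFT although the area (|X||T|/N = 1) gives only the trivial
bound 1). Proof: the level-one sandwich rows {0,1} × columns {0,2} of F₄/2 is (1/2)[[1,1],[1,−1]],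
norm r₁ = 1/√2 < 1, and Dyatlov–Jin's submultiplicativity Lemma 2.2 (general X₁,Y₁,X₂,Y₂; position
set C_k(A) = C_(k₁)(A) + 4^(k₁)C_(k₂)(A), frequency set likewise) gives r_k ≤ r₁^k. [difficulty: M] -/
@[route_item "route-QuantumAdvantage-AreaUncertainty"]
def CyclicCantorDecays : Prop :=
  ∀ (k : ℕ) (u : ZMod (4 ^ k) → ℂ), (∀ x : ZMod (4 ^ k), (∃ j, j < k ∧ (x.val / 4 ^ j) % 4 ∉ ({0, 2} : Finset ℕ)) → u x = 0) → ∑ y ∈ (Finset.univ.filter fun y : ZMod (4 ^ k) => ∀ j, j < k → (y.val / 4 ^ j) % 4 ∈ ({0, 1} : Finset ℕ)), ‖ZMod.dft u y‖ ^ 2 ≤ (2 : ℝ) ^ k * ∑ x, ‖u x‖ ^ 2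

/-- item stmt-QuantumAdvantage-2627 · assembly · rank 1 · open · by planner
sources: Shor1997, Shi2005
[assembly] GraphHSPInBQP → GraphHSPHard → QuantumAdvantage. -/
@[route_item "route-QuantumAdvantage-AreaUncertainty"]
def Assembly : Prop :=
  GraphHSPInBQP → GraphHSPHard → QuantumAdvantage

/-! D-0027 §2.1 — DECIDING THEOREM (planner-authored via `route open/edit --closes-file`; by planner-plancard-QuantumAdvantage-QuantumAdva-7a08b417-0 2026-08-15T14:04:54Z):
its hypotheses are this route's items and its conclusion the sub-problem Statement (glue_lint), and it elaborates with this file. -/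

@[closes "route-QuantumAdvantage-AreaUncertainty"] theorem closes : GraphHSPInBQP → GraphHSPHard → QuantumAdvantage := by
  intro hBQP hHard
  obtain ⟨F, Nf, d, hF, hN, hNd, hsep, hnot⟩ := hHard
  exact ⟨_, hBQP F Nf d hF hN hNd hsep, hnot⟩

end Summit.QuantumAdvantage.QuantumAdvantage.Theses.AreaUncertainty
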